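import Literature.MathematicalPhysics.QuantumFieldTheory.Balaban1983to89.B5QGGQ145Position
import Literature.MathematicalPhysics.QuantumFieldTheory.Balaban1983to89.B5DirichletDg

/-!
# `Balaban1983to89.B5DPD126Gradient` — the `∂`-kernels on the fine torus and the torus-model (1.126)/(1.128) for
# `∂P∂^* = ∂·(G′Q′^*)·(Q′G′²Q′^*)⁻¹·(Q′G′)·∂ᵀ` with NO analytic hypothesis left (`U = 1`, multiplier model)

T. Bałaban, *Propagators and renormalization transformations for lattice gauge theories. I*, Commun. Math. Phys.
**95**, 17–40 (1984) [Balaban1984PropagatorsI] (cell paper B5): p. 26 [PDF 10] ((1.48)), p. 37 [PDF 21] ((1.120),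
(1.121)), p. 38 [PDF 22] ((1.126), (1.128)).  Renders `1984-cmp95-propagators-rt-I-p009-x2.png`, `-p010-x2.png`,
`-p021-x2.png`, `-p022-x2.png` (cell folder `b2b-balaban-ref1/pages/`) read as images by this seat (pv15-g6).

CITATION HEADER (lean-in-tree rule 2026-08-18).  PRINTED, p. 37, verbatim: *"(∂P∂^*hA)_μ(x) = Σ_{x′,ν}
η^d(∂P∂^*)_{μν}(x, x′)h(x′)A_ν(x′)"* … *"These equalities imply Δ_a hA = (Δ − ∂P∂^* + aQ^*Q)hA = … = hΔ_aA − K(h)A,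
(1.121)"*.  P. 38, verbatim: *"Let us write bounds for the operator ∂P∂^*. They follow from the representation
P = G′Q′^*(Q′G′²Q′^*)^{−1}Q′G′, from Lemma 2.4 of [2], and the representation (1.45) and the analyticity method of proving
an exponential decay (see the proof of Lemma 2.4 in [2]). We obtain |(∂P∂^*)_{μ,ν}(x, x′)| ≦ O(1)e^{−δ′₀|x−x′|}, (1.126)"* …
*"The constant O(1) in (1.126) depends on d only"* … *"Defining 2δ₀ = min{⅓δ′₀, M₀^{−1}}, we obtain
|h_{z₁}K(h_{z₂})A| ≦ O(M₀^{−1})e^{−2δ₀|z₁−z₂|}(|∇A| + |A|). (1.128)"*.  P. 26, verbatim (the sign of `Δ`): *"h(A, ω, λ) =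
½⟨∂A, ∂A⟩ + ⟨ω, Q_kA − B⟩ + ⟨λ, R∂^*A⟩ = ½⟨A, ΔA⟩ − ½⟨∂^*A, ∂^*A⟩ + ⟨ω, Q_kA − B⟩ + ⟨λ, R∂^*A⟩, Rλ = λ, (1.48)"* — so the
printed `Δ` is the POSITIVE operator with `⟨A, ΔA⟩ = ‖∂A‖² + ‖∂^*A‖²`.

WHAT THE CELL ALREADY HAS (imported, untouched).  b05-g7's `B5QGGQ145Position` (XREAD by this seat, GAPS C-pv15g6-1):
on the vector-field carrier `UT (n·N) × Fin (d+1)` of pv15's `B5Decay126.h128_of_constituents` the padded factors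
`KReV` (`G′Q′^*`, scalar hosted on the component `0`), `QGReV` (`Q′G′`), `OneV = 1`, `inv_padded`
(`(QGReV·1·1·KReV)⁻¹ = kerRe`), and the two leaves **`decay126_multiplier`** ((1.126): for ANY kernels `D, D′` with
`PosDecay` at rate `κ₀/((d+1)n)` the kernel `D·1·KReV·(QGReV·1·1·KReV)⁻¹·QGReV·1·D′` decays, constants `torusConst126 /
torusRate126`) and **`h128_multiplier`** ((1.128) likewise) — every factor hypothesis `hG hB hBst hM hm₁ hm₂` discharged
from b04 (B4 Lemma 2.4 on the torus), pv17 ((1.45) strip bounds) and b05 (Gram factorisation).  LOCATED GAP (cell census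
G-B5-38 (a)(c), b05-g7): the `∂`-KERNELS `D, D′` themselves — prescribed there as `((x,μ),(z,λ)) ↦ [λ = 0]·∂_μ(x,z)` and
its adjoint form — with their finite-range decay, the resulting hypothesis-free leaves, and (caveat in G-B5-38 (a)) the
check of the sign conventions of `B5Leibniz121.lapKer` against the literal `Δ_a` of (1.121).

THIS FILE (journal node DPD-126-GRADIENT of the cell `pub-balaban`, unit b2b-balaban-pv15-g6) closes G-B5-38 (a), (c)
and the sign caveat, and applies the (b)-witness of `B5DirichletDg`, sorry-free:
* §1 THE `∂`-KERNELS: `VIdx n N := UT (n·N) × Fin (d+1)` (`dn_up`, `eq_up_iff` — `y = x + e_μ ↔ x = y − e_μ` — are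
  imported from `B5DirichletDg`); the honest scalar→vector forward gradient **`grad0 : Matrix (VIdx n N) (UT (n·N)) ℝ`**,
  `grad0 (x,μ) y = δ_{y,x+e_μ} − δ_{y,x}`, with **`grad0_mulVec`** (`(grad0 f)(x,μ) = f(x + e_μ) − f(x)`) and
  **`grad0_transpose_mulVec`** (`(grad0ᵀ A)(y) = Σ_μ (A(y − e_μ, μ) − A(y, μ))` — the `ℓ²`-adjoint, minus the backward
  divergence); the prescribed padded kernels **`gradK`** (`(x,μ),(y,ν) ↦ [ν = 0]·grad0 (x,μ) y`) and
  **`divK := gradKᵀ`**; `gradK_apply`, `abs_gradK_le` / `abs_divK_le` (entries `≤ 1`), `gradK_eq_zero` / `divK_eq_zero`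
  (range `1`, `B5Leibniz121.dist_up_le`), and **`gradK_posDecay` / `divK_posDecay`**: `PosDecay dist Prod.fst Prod.fst
  (gradK n N) (e^{δ}) δ` for EVERY `δ ≥ 0` (pv15's `PosDecay.of_finiteRange`) — the hypotheses `hD`, `hD′` DISCHARGED;
* §2 THE KERNEL: `KReU`, `QGReU` (b05's `KRe`, `QGRe` re-indexed by the sites of the carrier), `gradK_mul_KReV`
  (`gradK·KReV = grad0·KReU`), `QGReV_mul_divK` (`QGReV·divK = QGReU·grad0ᵀ`), **`kernel_eq`** (the engine's expression at
  `D := gradK`, `D′ := divK` is `gradK·KReV·kerRe·QGReV·divK`) and **`kernel_scalar_eq`** (… `= grad0·KReU·kerRe·(QGReU·grad0ᵀ)`: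
  the component-`0` hosting device of `KReV`/`QGReV`/`gradK` is immaterial — the kernel IS the scalar composition
  `∂ (G′Q′^*) (Q′G′²Q′^*)⁻¹ (Q′G′) ∂^*` over the SITES);
* §3 **(1.126) HYPOTHESIS-FREE**: **`decay126_gradient`** — `∃ κ₀ > 0, C ≥ 0, γ₀ > 0, ∀ n ≥ 1, a ∈ [a₋,a₊], N:
  PosDecay dist Prod.fst Prod.fst (gradK·KReV·kerRe·QGReV·divK) (torusConst126 (d+1) (d+1) 1 e^{δ} e^{δ} 1 C C γ₀ δ)
  (torusRate126 (d+1) (d+1) 1 1 C C γ₀ δ)`, `δ = κ₀/((d+1)n)` — the only inputs are `0 < a₋ ≤ a₊`, `n ≥ 1` and the torus;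
  **`abs_dPd_le`** (the same ENTRYWISE in the printed shape `|(∂P∂^*)_{μν}(x,x′)| ≤ O(1)e^{−δ′₀ dist(x,x′)}` for the
  scalar-site composition; the rate is positive by b05-g7's `decay126_multiplier_rate_pos`);
* §4 **(1.128) WITH `∂P∂^*` INSTANTIATED**: **`h128_gradient`** — b05's `h128_multiplier` at `D := gradK`, `D′ := divK`:
  the inputs LEFT are structural only — the mesh `M₀` (`1 ≤ M₀`, `2M₀ ≤ nN_μ`), an operator `Dg` dominating the
  vector-field Dirichlet form (`√dirichlet(axisWC) A ≤ ‖Dg A‖`, the printed `|∇A|`; kept abstract as in pv15/b05 — G-B5-38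
  (b)), and the coefficient `a′` of `a′Q^*Q`;
* §5 **(1.128) FOR THE LITERAL SIGN PATTERN OF (1.121)**: `kerOp_eq_neg`, b05-g6's `B5Averaging120.Kop_neg` (`K(h) =
  hΔ_a − Δ_ah` is linear in `Δ_a`), `posDecay_neg`, and **`h128_gradient_literal`** — the same bound for the single kernel operator with kernel
  `−lapKer axisWC + a′·gram120 − (gradK·KReV·kerRe·QGReV·divK)`, i.e. `Δ + a′Q^*Q − ∂P∂^*` with `Δ` Bałaban's POSITIVE
  Laplacian: pv15's `kerOp (lapKer w)` is `(ΔA)_i = Σ_j w_ij(A_j − A_i)` = MINUS the positive `Σ_μ ∂_μ^*∂_μ` of (1.48), so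
  the operator of `h128_multiplier`/`h128_gradient`, `kerOp(lapKer + a′gram) + kerOp(−DPD′)`, is `−Δ + a′Q^*Q − DPD′`, and the
  literal `Δ_a` is MINUS that operator at `(−a′, −∂)`; the estimate is insensitive (G-B5-38 (a) caveat DISCHARGED).
* §6 **(1.128) FULLY INSTANTIATED**: with pv15-g6's `B5DirichletDg` (G-B5-38 (b): the concrete Dirichlet operator
  `DgAxis`, `‖DgAxis A‖ = √(dirichlet axisWC A)`), **`h128_gradient_concrete`** — the bound of `h128_gradient` with
  `‖Dg A‖` replaced by `√(dirichlet axisWC A)`: `∂P∂^*` AND `|∇A|` instantiated; inputs left: the mesh `M₀` and `a′`.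

DICTIONARY / HONEST SCOPE.  Units and model as in `B5QGGQ145Torus/Bounds/Factor/Position` (`ξ`-units: fine torus
`T_ξ = Π_μ ℤ/(nN_μ)` with unit spacing, `n = L^k`, unit torus `T₁ = Π_μ ℤ/N_μ`, `m² = 0`, `U = 1`, counting measure, the
weight `ξ^{d+1}` inside `QGRe`; the printed dimension `d` is `d+1` here).  (i) `∂` is the forward difference with UNIT
spacing and `∂^* = ∂ᵀ` its counting-measure adjoint (`grad0_transpose_mulVec`); Bałaban's `∂^η_μ`, `∂^{η*}_μ` carry the
factor `η⁻¹` and, for `U ≠ 1`, parallel transports — NOT typed (G-B5-38 (d) `η`-rescaling, (e) gauge fields).  (ii) As in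
b05's HONEST SCOPE (i): rates are per FINE step (`δ = κ₀/((d+1)n)` = `κ₀/(d+1)` per `ξ`-unit length, uniform in `k` and
the volume); the OUTPUT constants `torusConst126`, `torusRate126`, `twoDelta0` are explicit functions of `n` through `δ` and
pv15's lattice profiles and are NOT claimed uniform in `n` (the printed "O(1) … depends on d only" is the `η`-weighted
statement).  (iii) `Dg` abstract in §4–§5 and instantiated by `DgAxis` in §6 (`‖DgAxis A‖² = dirichlet` counts each edge twice =
`2‖∂A‖²` in `ξ`-units — the `√2` and the `η`-weights go with (d)); `a′` decoupled from `a` (b05's (iv)).  (iv) The component-`0` hosting is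
b05's prescription; §2 proves it immaterial.  Value = kernel certificate closing a located gap of the cell census (the
last analytic inputs `hD`, `hD′` of the torus-model (1.126)/(1.128) discharged; the sign dictionary for (1.121) settled),
NOT summit progress.  Nothing imported is edited; staged byte-identically under `HOME/lean/BalabanYm4/`.

Tags: 6 `[cite: …]` (`kernel_eq`, `decay126_gradient`, `abs_dPd_le`, `h128_gradient`, `h128_gradient_literal`,
`h128_gradient_concrete`: the printed grouping of `∂P∂^*` and the printed (1.126)/(1.128) conclusions), 20 `[folklore]`.
No `sorry`, no new axioms; imports `B5QGGQ145Position` (b05-g7) and `B5DirichletDg` (pv15-g6) only.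
-/

namespace Literature.MathematicalPhysics.QuantumFieldTheory.Balaban1983to89.B5DPD126Gradient

open Finset
open Literature.MathematicalPhysics.QuantumFieldTheory.Balaban1983to89.B5TorusCover
open Literature.MathematicalPhysics.QuantumFieldTheory.Balaban1983to89.B5Decay126
open Literature.MathematicalPhysics.QuantumFieldTheory.Balaban1983to89.B5QGGQ145Bounds
open Literature.MathematicalPhysics.QuantumFieldTheory.Balaban1983to89.B5QGGQ145Factor
open Literature.MathematicalPhysics.QuantumFieldTheory.Balaban1983to89.B5QGGQ145Position
open Literature.MathematicalPhysics.QuantumFieldTheory.Balaban1983to89.B5DirichletDg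
open Literature.MathematicalPhysics.QuantumFieldTheory.Balaban1983to89.B5Leibniz121 (up dn up_dn dist_up_le)
open scoped Real Matrix

noncomputable section

variable {d : ℕ}

/-! ### §1 The vector-field index and the `∂`-kernels on the fine torus -/

/-- the VECTOR-FIELD INDEX of the fine torus `T_ξ = Π_μ ℤ/(nN_μ)`: pairs `(x, μ)` (site, direction) — the `ι` of
`h128_of_constituents` / `h128_multiplier` (`πf = Prod.fst`). [folklore] -/
abbrev VIdx (n : ℕ) (N : Fin (d + 1) → ℕ) : Type := UT (fun i => n * N i) × Fin (d + 1)

/-- **THE FORWARD GRADIENT FROM SCALARS TO VECTOR FIELDS**: `grad0 (x,μ) y = δ_{y,x+e_μ} − δ_{y,x}`, i.e.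
`(∂f)_μ(x) = f(x + e_μ) − f(x)` (`ξ`-units, unit spacing, `U = 1`). [folklore] -/
def grad0 (n : ℕ) [NeZero n] (N : Fin (d + 1) → ℕ) [∀ i, NeZero (N i)] :
    Matrix (VIdx n N) (UT (fun i => n * N i)) ℝ :=
  Matrix.of fun p y => (if y = up p.1 p.2 then (1 : ℝ) else 0) - (if y = p.1 then (1 : ℝ) else 0)

/-- `grad0` ACTS as the forward lattice gradient: `(grad0 f)(x,μ) = f(x + e_μ) − f(x)`. [folklore] -/
theorem grad0_mulVec (n : ℕ) [NeZero n] (N : Fin (d + 1) → ℕ) [∀ i, NeZero (N i)]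
    (f : UT (fun i => n * N i) → ℝ) (p : VIdx n N) :
    (grad0 n N).mulVec f p = f (up p.1 p.2) - f p.1 := by
  simp only [Matrix.mulVec, dotProduct, grad0, Matrix.of_apply, sub_mul, Finset.sum_sub_distrib, ite_mul, one_mul,
    zero_mul, Finset.sum_ite_eq', Finset.mem_univ, if_true]

/-- `grad0ᵀ` ACTS as minus the backward divergence: `(grad0ᵀ A)(y) = Σ_μ (A(y − e_μ, μ) − A(y, μ))` — the
`ℓ²`-adjoint `∂^*` of `∂` for counting measure. [folklore] -/
theorem grad0_transpose_mulVec (n : ℕ) [NeZero n] (N : Fin (d + 1) → ℕ) [∀ i, NeZero (N i)]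
    (A : VIdx n N → ℝ) (y : UT (fun i => n * N i)) :
    (grad0 n N)ᵀ.mulVec A y = ∑ μ : Fin (d + 1), (A (dn y μ, μ) - A (y, μ)) := by
  simp only [Matrix.mulVec, dotProduct, Matrix.transpose_apply, grad0, Matrix.of_apply]
  rw [Fintype.sum_prod_type, Finset.sum_comm]
  refine Finset.sum_congr rfl fun μ _ => ?_
  simp only [sub_mul, Finset.sum_sub_distrib, ite_mul, one_mul, zero_mul]
  congr 1
  · simp_rw [eq_up_iff _ y μ]
    rw [Finset.sum_ite_eq' Finset.univ (dn y μ)]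
    simp
  · simp_rw [@eq_comm _ y]
    rw [Finset.sum_ite_eq' Finset.univ y]
    simp

/-- **THE `∂`-KERNEL `D` ON THE VECTOR-FIELD CARRIER** (b05-g7's prescription `((x,μ),(z,λ)) ↦ [λ = 0]·∂_μ(x,z)`, the
scalar hosted in the component `0` as in `KReV`, `QGReV`): `gradK (x,μ) (y,ν) = [ν = 0]·(δ_{y,x+e_μ} − δ_{y,x})`. [folklore] -/
def gradK (n : ℕ) [NeZero n] (N : Fin (d + 1) → ℕ) [∀ i, NeZero (N i)] : Matrix (VIdx n N) (VIdx n N) ℝ :=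
  Matrix.of fun p q => if q.2 = 0 then grad0 n N p q.1 else 0

/-- **THE `∂^*`-KERNEL `D′`**: the transpose `gradKᵀ` (`ℓ²`-adjoint for counting measure with unit spacing). [folklore] -/
def divK (n : ℕ) [NeZero n] (N : Fin (d + 1) → ℕ) [∀ i, NeZero (N i)] : Matrix (VIdx n N) (VIdx n N) ℝ :=
  (gradK n N)ᵀ

/-- the entries of `gradK`. [folklore] -/
theorem gradK_apply (n : ℕ) [NeZero n] (N : Fin (d + 1) → ℕ) [∀ i, NeZero (N i)] (p q : VIdx n N) :
    gradK n N p q = if q.2 = 0 then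
      (if q.1 = up p.1 p.2 then (1 : ℝ) else 0) - (if q.1 = p.1 then (1 : ℝ) else 0) else 0 := rfl

/-- `|∂(p,q)| ≤ 1`. [folklore] -/
theorem abs_gradK_le (n : ℕ) [NeZero n] (N : Fin (d + 1) → ℕ) [∀ i, NeZero (N i)] (p q : VIdx n N) :
    |gradK n N p q| ≤ 1 := by
  rw [gradK_apply]
  split_ifs <;> simp

/-- `∂` has range `1`: `∂(p,q) = 0` unless `dist(p.1, q.1) ≤ 1` (`B5Leibniz121.dist_up_le`). [folklore] -/
theorem gradK_eq_zero (n : ℕ) [NeZero n] (N : Fin (d + 1) → ℕ) [∀ i, NeZero (N i)] {p q : VIdx n N}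
    (h : 1 < dist p.1 q.1) : gradK n N p q = 0 := by
  rw [gradK_apply]
  have h1 : q.1 ≠ up p.1 p.2 := by
    intro he
    have := dist_up_le p.1 p.2
    rw [← he] at this
    linarith
  have h2 : q.1 ≠ p.1 := by
    intro he
    rw [he, dist_self] at h
    linarith
  simp [h1, h2]

/-- `|∂ᵀ(p,q)| ≤ 1`. [folklore] -/
theorem abs_divK_le (n : ℕ) [NeZero n] (N : Fin (d + 1) → ℕ) [∀ i, NeZero (N i)] (p q : VIdx n N) :
    |divK n N p q| ≤ 1 := by
  unfold divK; rw [Matrix.transpose_apply]; exact abs_gradK_le n N q p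

/-- `∂ᵀ` has range `1`. [folklore] -/
theorem divK_eq_zero (n : ℕ) [NeZero n] (N : Fin (d + 1) → ℕ) [∀ i, NeZero (N i)] {p q : VIdx n N}
    (h : 1 < dist p.1 q.1) : divK n N p q = 0 := by
  unfold divK; rw [Matrix.transpose_apply]; exact gradK_eq_zero n N (by rwa [dist_comm])

/-- **hypothesis `hD` DISCHARGED**: `∂` decays at EVERY rate `δ ≥ 0` with constant `e^{δ}` (finite range `1`, entries
`≤ 1`; pv15's `PosDecay.of_finiteRange`). [folklore] -/
theorem gradK_posDecay (n : ℕ) [NeZero n] (N : Fin (d + 1) → ℕ) [∀ i, NeZero (N i)] {δ : ℝ} (hδ : 0 ≤ δ) :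
    PosDecay (fun x y : UT (fun i => n * N i) => dist x y) Prod.fst Prod.fst (gradK n N) (Real.exp δ) δ := by
  have h := PosDecay.of_finiteRange (dX := fun x y : UT (fun i => n * N i) => dist x y) (pa := Prod.fst)
    (pb := Prod.fst) (A := gradK n N) (r := 1) hδ zero_le_one (abs_gradK_le n N) (fun p q hpq => gradK_eq_zero n N hpq)
  exact h.const_mono (le_of_eq (by rw [one_mul, mul_one]))

/-- **hypothesis `hD′` DISCHARGED**: `∂ᵀ` decays at every rate `δ ≥ 0` with constant `e^{δ}`. [folklore] -/
theorem divK_posDecay (n : ℕ) [NeZero n] (N : Fin (d + 1) → ℕ) [∀ i, NeZero (N i)] {δ : ℝ} (hδ : 0 ≤ δ) :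
    PosDecay (fun x y : UT (fun i => n * N i) => dist x y) Prod.fst Prod.fst (divK n N) (Real.exp δ) δ := by
  have h := PosDecay.of_finiteRange (dX := fun x y : UT (fun i => n * N i) => dist x y) (pa := Prod.fst)
    (pb := Prod.fst) (A := divK n N) (r := 1) hδ zero_le_one (abs_divK_le n N) (fun p q hpq => divK_eq_zero n N hpq)
  exact h.const_mono (le_of_eq (by rw [one_mul, mul_one]))


/-! ### §2 The kernel `∂P∂^*` of the model: the engine's expression, the factorised form, and the scalar form over
the sites -/

/-- `G′Q′^*` with rows = the SITES of the fine torus (b05's `KRe` re-indexed through the carrier synonym `UT`). [folklore] -/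
def KReU (n : ℕ) [NeZero n] (a : ℝ) (N : Fin (d + 1) → ℕ) : Matrix (UT (fun i => n * N i)) (Idx N) ℝ :=
  Matrix.of fun y k => KRe n a N (UT.toSite _ y) k

/-- `Q′G′` with columns = the sites of the fine torus. [folklore] -/
def QGReU (n : ℕ) [NeZero n] (a : ℝ) (N : Fin (d + 1) → ℕ) : Matrix (Idx N) (UT (fun i => n * N i)) ℝ :=
  Matrix.of fun k y => QGRe n a N k (UT.toSite _ y)

/-- `∂ · KReV = grad0 · KReU`: composing through the hosting component `0` IS the scalar composition over the sites.
[folklore] -/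
theorem gradK_mul_KReV (n : ℕ) [NeZero n] (a : ℝ) (N : Fin (d + 1) → ℕ) [∀ i, NeZero (N i)] :
    gradK n N * KReV n a N = grad0 n N * KReU n a N := by
  ext p k
  simp only [Matrix.mul_apply, gradK, KReV, KReU, Matrix.of_apply]
  rw [Fintype.sum_prod_type]
  have h : ∀ (x : UT (fun i => n * N i)) (ν : Fin (d + 1)),
      (if ν = 0 then grad0 n N p x else 0) * (if ν = 0 then KRe n a N (UT.toSite _ x) k else 0)
        = if ν = 0 then grad0 n N p x * KRe n a N (UT.toSite _ x) k else 0 := by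
    intro x ν
    split_ifs <;> simp
  simp_rw [h, Finset.sum_ite_eq', Finset.mem_univ, if_true]

/-- `QGReV · ∂ᵀ = QGReU · grad0ᵀ`. [folklore] -/
theorem QGReV_mul_divK (n : ℕ) [NeZero n] (a : ℝ) (N : Fin (d + 1) → ℕ) [∀ i, NeZero (N i)] :
    QGReV n a N * divK n N = QGReU n a N * (grad0 n N)ᵀ := by
  ext k p
  simp only [Matrix.mul_apply, divK, Matrix.transpose_apply, gradK, QGReV, QGReU, Matrix.of_apply]
  rw [Fintype.sum_prod_type]
  have h : ∀ (x : UT (fun i => n * N i)) (ν : Fin (d + 1)),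
      (if ν = 0 then QGRe n a N k (UT.toSite _ x) else 0) * (if ν = 0 then grad0 n N p x else 0)
        = if ν = 0 then QGRe n a N k (UT.toSite _ x) * grad0 n N p x else 0 := by
    intro x ν
    split_ifs <;> simp
  simp_rw [h, Finset.sum_ite_eq', Finset.mem_univ, if_true]

/-- **THE ENGINE'S KERNEL WITH `D := ∂`, `D′ := ∂ᵀ` IS `∂·(G′Q′^*)·(Q′G′²Q′^*)⁻¹·(Q′G′)·∂ᵀ`** with pv17's real inverse
kernel `kerRe = (qggqRe)⁻¹` in the middle (`inv_padded`). [cite: Balaban1984PropagatorsI, p.38 ("They follow from the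
representation P = G′Q′^*(Q′G′²Q′^*)⁻¹Q′G′")] -/
theorem kernel_eq (n : ℕ) [NeZero n] (hn1 : 1 ≤ n) (a : ℝ) (ha : 0 < a) (N : Fin (d + 1) → ℕ) [∀ i, NeZero (N i)] :
    gradK n N * OneV n N * KReV n a N * (QGReV n a N * OneV n N * OneV n N * KReV n a N)⁻¹ * QGReV n a N * OneV n N
        * divK n N
      = gradK n N * KReV n a N * kerRe n a N * QGReV n a N * divK n N := by
  rw [inv_padded n hn1 a ha (UT.one_le N)]
  simp only [OneV, Matrix.mul_one]

/-- **… AND IT IS THE SCALAR COMPOSITION OVER THE SITES**: `grad0 · KReU · kerRe · (QGReU · grad0ᵀ)` — the component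
`0` used to host the scalar field on the vector-field carrier plays no role. [folklore] -/
theorem kernel_scalar_eq (n : ℕ) [NeZero n] (hn1 : 1 ≤ n) (a : ℝ) (ha : 0 < a) (N : Fin (d + 1) → ℕ)
    [∀ i, NeZero (N i)] :
    gradK n N * OneV n N * KReV n a N * (QGReV n a N * OneV n N * OneV n N * KReV n a N)⁻¹ * QGReV n a N * OneV n N
        * divK n N
      = grad0 n N * KReU n a N * kerRe n a N * (QGReU n a N * (grad0 n N)ᵀ) := by
  rw [kernel_eq n hn1 a ha N, gradK_mul_KReV, Matrix.mul_assoc (grad0 n N * KReU n a N * kerRe n a N),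
    QGReV_mul_divK]


/-! ### §3 (1.126) for `∂·(G′Q′^*)·(Q′G′²Q′^*)⁻¹·(Q′G′)·∂ᵀ` with NO hypothesis left -/

/-- **B5 (1.126) IN THE TORUS MULTIPLIER MODEL, HYPOTHESIS-FREE** — b05-g7's `decay126_multiplier` (pv15's engine
`decay126_torus` with `hG hB hBst hM hm₁ hm₂` discharged) at `D := ∂ = gradK`, `D′ := ∂ᵀ = divK` (`hD`, `hD′` discharged
by `gradK_posDecay`, `divK_posDecay`): for `0 < a₋ ≤ a₊` there are `κ₀ > 0`, `C ≥ 0`, `γ₀ > 0` such that for every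
`n = L^k ≥ 1`, every `a ∈ [a₋,a₊]` and every unit torus `Π_μ ℤ/N_μ`, with `δ = κ₀/((d+1)n)`,
`|(∂·G′Q′^*·(Q′G′²Q′^*)⁻¹·Q′G′·∂ᵀ)((x,μ),(x′,ν))| ≤ torusConst126 … · e^{−torusRate126 … · dist(x,x′)}` — the ONLY
inputs are `0 < a₋ ≤ a₊`, `n ≥ 1` and the torus (uniform in the volume and in `a`; the dependence on `n` through `δ`
and the engine's profiles is that of fine-lattice units with counting measure — module docstring, HONEST SCOPE).
[cite: Balaban1984PropagatorsI, (1.126) p.38] -/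
theorem decay126_gradient (d : ℕ) (aminus aplus : ℝ) (ha : 0 < aminus) :
    ∃ κ₀ C γ₀ : ℝ, 0 < κ₀ ∧ 0 ≤ C ∧ 0 < γ₀ ∧ ∀ (n : ℕ) [NeZero n], 1 ≤ n → ∀ a : ℝ, aminus ≤ a → a ≤ aplus →
      ∀ (N : Fin (d + 1) → ℕ) [∀ i, NeZero (N i)],
        PosDecay (fun x y : UT (fun i => n * N i) => dist x y) Prod.fst Prod.fst
          (gradK n N * KReV n a N * kerRe n a N * QGReV n a N * divK n N)
          (torusConst126 (d + 1) (d + 1) 1 (Real.exp (κ₀ / ((d + 1) * n))) (Real.exp (κ₀ / ((d + 1) * n))) 1 C C γ₀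
            (κ₀ / ((d + 1) * n)))
          (torusRate126 (d + 1) (d + 1) 1 1 C C γ₀ (κ₀ / ((d + 1) * n))) := by
  obtain ⟨κ₀, C, γ₀, hκ, hC, hγ, h⟩ := decay126_multiplier d aminus aplus ha
  refine ⟨κ₀, C, γ₀, hκ, hC, hγ, fun n _ hn1 a ha1 ha2 N _ => ?_⟩
  have hδ : 0 ≤ κ₀ / ((d + 1) * n) := by
    have : (0 : ℝ) < n := by exact_mod_cast hn1
    positivity
  have h' := h n hn1 a ha1 ha2 N (gradK n N) (divK n N) _ _ (gradK_posDecay n N hδ) (divK_posDecay n N hδ)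
  rwa [kernel_eq n hn1 a (lt_of_lt_of_le ha ha1) N] at h'

/-- the same, ENTRYWISE, in the printed shape `|(∂P∂^*)_{μν}(x, x′)| ≤ O(1)·e^{−δ′₀|x − x′|}` and with the scalar
operators composed over the sites (`kernel_scalar_eq`). [cite: Balaban1984PropagatorsI, (1.126) p.38] -/
theorem abs_dPd_le (d : ℕ) (aminus aplus : ℝ) (ha : 0 < aminus) :
    ∃ κ₀ C γ₀ : ℝ, 0 < κ₀ ∧ 0 ≤ C ∧ 0 < γ₀ ∧ ∀ (n : ℕ) [NeZero n], 1 ≤ n → ∀ a : ℝ, aminus ≤ a → a ≤ aplus →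
      ∀ (N : Fin (d + 1) → ℕ) [∀ i, NeZero (N i)] (x : UT (fun i => n * N i)) (μ : Fin (d + 1))
        (x' : UT (fun i => n * N i)) (ν : Fin (d + 1)),
        |(grad0 n N * KReU n a N * kerRe n a N * (QGReU n a N * (grad0 n N)ᵀ)) (x, μ) (x', ν)|
          ≤ torusConst126 (d + 1) (d + 1) 1 (Real.exp (κ₀ / ((d + 1) * n))) (Real.exp (κ₀ / ((d + 1) * n))) 1 C C γ₀
              (κ₀ / ((d + 1) * n))
            * Real.exp (-(torusRate126 (d + 1) (d + 1) 1 1 C C γ₀ (κ₀ / ((d + 1) * n)) * dist x x')) := by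
  obtain ⟨κ₀, C, γ₀, hκ, hC, hγ, h⟩ := decay126_gradient d aminus aplus ha
  refine ⟨κ₀, C, γ₀, hκ, hC, hγ, fun n _ hn1 a ha1 ha2 N _ x μ x' ν => ?_⟩
  have h' := (h n hn1 a ha1 ha2 N).2 (x, μ) (x', ν)
  rwa [← kernel_eq n hn1 a (lt_of_lt_of_le ha ha1) N, kernel_scalar_eq n hn1 a (lt_of_lt_of_le ha ha1) N] at h'


/-! ### §4 (1.128) in the torus multiplier model with `∂P∂^*` fully instantiated -/

/-- **B5 (1.128) IN THE TORUS MULTIPLIER MODEL WITH `∂P∂^* := ∂·(G′Q′^*)·(Q′G′²Q′^*)⁻¹·(Q′G′)·∂ᵀ`** — b05-g7's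
`h128_multiplier` (pv15's `h128_of_constituents`: `‖h_{z₁}K(h_{z₂})A‖ ≤ O(M₀⁻¹)e^{−2δ₀ dist(z₁,z₂)}(‖Dg A‖ + ‖A‖)` for
`Δ_a = Δ + a′Q^*Q − ∂P∂^*` on the fine torus `Π_μ ℤ/(nN_μ)`, smooth partition of mesh `M₀` fine steps) at `D := ∂ = gradK`,
`D′ := ∂ᵀ = divK`: the inputs LEFT are purely structural — the mesh (`1 ≤ M₀`, `2M₀ ≤ nN_μ`), an operator `Dg`
dominating the vector-field Dirichlet form (`‖∇A‖ ≤ ‖Dg A‖`, the printed `|∇A|`), and the coefficient `a′` of `a′Q^*Q`.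
No decay, coercivity or Green-function hypothesis remains.
[cite: Balaban1984PropagatorsI, (1.128) p.38 with (1.121) p.37 and (1.126) p.38] -/
theorem h128_gradient (d : ℕ) (aminus aplus : ℝ) (ha : 0 < aminus) :
    ∃ κ₀ C γ₀ : ℝ, 0 < κ₀ ∧ 0 ≤ C ∧ 0 < γ₀ ∧ ∀ (n : ℕ) [NeZero n], 1 ≤ n → ∀ a : ℝ, aminus ≤ a → a ≤ aplus →
      ∀ (N : Fin (d + 1) → ℕ) [∀ i, NeZero (N i)] (M₀ : ℕ), 1 ≤ M₀ → (∀ i, 2 * M₀ ≤ n * N i) →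
        ∀ (Dg : Module.End ℝ (EuclideanSpace ℝ (VIdx n N))),
          (∀ A, Real.sqrt (B5Leibniz121.dirichlet
              (B5Leibniz121.axisWC (N := fun i => n * N i) (κ := Fin (d + 1))) A) ≤ ‖Dg A‖) →
        ∀ (a' : ℝ) (z₁ z₂ : B5TorusCover.Ctr (fun i => n * N i) M₀) (A : EuclideanSpace ℝ (VIdx n N)),
            ‖B5SmoothPartition.HSop (fun i => n * N i) M₀ (fun p : VIdx n N => p.1) z₁
                (B5Local114.Kop
                  (B5Commutator128.kerOp (fun i j => B5Leibniz121.lapKer B5Leibniz121.axisWC i j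
                      + a' * B5Averaging120.gram120 ((n : ℝ) ^ (d + 1)) (B5AveragingTorus.avgKer n) i j)
                    + B5Commutator128.kerOp (fun i j =>
                        -((gradK n N * KReV n a N * kerRe n a N * QGReV n a N * divK n N) i j)))
                  (B5SmoothPartition.HSop (fun i => n * N i) M₀ (fun p : VIdx n N => p.1)) z₂ A)‖
              ≤ (((4 * ((d + 1 : ℕ) : ℝ) / M₀ * Real.sqrt (2 * ((d + 1 : ℕ) : ℝ))
                        + 52 * ((d + 1 : ℕ) : ℝ) / (M₀ : ℝ) ^ 2)
                      + 4 * ((d + 1 : ℕ) : ℝ) / M₀ * (4 * n) * |a'|) * Real.exp (4 + 4 * n / M₀)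
                  + 4 * ((d + 1 : ℕ) : ℝ) / M₀
                    * torusConst126 (d + 1) (d + 1) 1 (Real.exp (κ₀ / ((d + 1) * n))) (Real.exp (κ₀ / ((d + 1) * n)))
                        1 C C γ₀ (κ₀ / ((d + 1) * n))
                    * (24 / (Real.exp 1 * torusRate126 (d + 1) (d + 1) 1 1 C C γ₀ (κ₀ / ((d + 1) * n))))
                    * (((d + 1 : ℕ) : ℝ) * B4Sect5Proof.latticeConst (d + 1)
                        (torusRate126 (d + 1) (d + 1) 1 1 C C γ₀ (κ₀ / ((d + 1) * n)) / 8)) * Real.exp 7)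
                * Real.exp (-(B5Walk131.twoDelta0 (torusRate126 (d + 1) (d + 1) 1 1 C C γ₀ (κ₀ / ((d + 1) * n))) M₀
                    * dist (B5TorusCover.ctrU (fun i => n * N i) M₀ z₁)
                        (B5TorusCover.ctrU (fun i => n * N i) M₀ z₂)))
                * (‖Dg A‖ + ‖A‖) := by
  obtain ⟨κ₀, C, γ₀, hκ, hC, hγ, h⟩ := h128_multiplier d aminus aplus ha
  refine ⟨κ₀, C, γ₀, hκ, hC, hγ, fun n _ hn1 a ha1 ha2 N _ M₀ hM h2N Dg hDg a' z₁ z₂ A => ?_⟩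
  have hδ : 0 ≤ κ₀ / ((d + 1) * n) := by
    have : (0 : ℝ) < n := by exact_mod_cast hn1
    positivity
  have h' := h n hn1 a ha1 ha2 N M₀ hM h2N Dg hDg a' (gradK n N) (divK n N) _ _ (gradK_posDecay n N hδ)
    (divK_posDecay n N hδ) z₁ z₂ A
  rwa [kernel_eq n hn1 a (lt_of_lt_of_le ha ha1) N] at h'



/-! ### §5 (1.128) with BAŁABAN'S SIGNS: `Δ_a = Δ + aQ^*Q − ∂P∂^*` with the POSITIVE Laplacian `Δ = Σ_μ ∂_μ^*∂_μ` -/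

/-- negating a kernel negates its operator. [folklore] -/
theorem kerOp_eq_neg {ι : Type} [Fintype ι] [DecidableEq ι] (k k' : ι → ι → ℝ) (h : ∀ i j, k i j = -k' i j) :
    B5Commutator128.kerOp k = -B5Commutator128.kerOp k' := by
  have h1 : B5Commutator128.kerOp (fun i j => k i j + k' i j) = 0 :=
    B5Commutator128.kerOp_eq_zero_of_forall fun i j => by rw [h]; ring
  rw [B5Commutator128.kerOp_add] at h1
  exact eq_neg_of_add_eq_zero_left h1

/-- a negated kernel decays with the same constant and rate. [folklore] -/
theorem posDecay_neg {α β X : Type*} {dX : X → X → ℝ} {pa : α → X} {pb : β → X} {A : Matrix α β ℝ} {c δ : ℝ}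
    (h : PosDecay dX pa pb A c δ) : PosDecay dX pa pb (-A) c δ :=
  ⟨h.1, fun a b => by rw [Matrix.neg_apply, abs_neg]; exact h.2 a b⟩

/-- **B5 (1.128) FOR THE LITERAL `Δ_a = Δ + a′Q^*Q − ∂P∂^*` OF (1.121)** — one kernel operator whose kernel is
`−lapKer axisWC` (pv15's `kerOp (lapKer w)` is `(ΔA)_i = Σ_j w_ij(A_j − A_i)`, i.e. MINUS Bałaban's positive
`Δ = Σ_μ ∂_μ^*∂_μ` of (1.48) "½⟨∂A, ∂A⟩ = ½⟨A, ΔA⟩ − ½⟨∂^*A, ∂^*A⟩") `+ a′·(Q^*Q kernel) − (∂·G′Q′^*·(Q′G′²Q′^*)⁻¹·Q′G′·∂ᵀ)`: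
since `K(h) = hΔ_a − Δ_ah` is linear in `Δ_a`, the bound of `h128_gradient` (applied at `−a′`, `D := −∂`) holds verbatim.
Inputs left: the mesh `M₀`, the Dirichlet-dominating operator `Dg`, the coefficient `a′`.
[cite: Balaban1984PropagatorsI, (1.128) p.38 with (1.121) p.37 ("Δ_a hA = (Δ − ∂P∂^* + aQ^*Q)hA = … = hΔ_aA − K(h)A")] -/
theorem h128_gradient_literal (d : ℕ) (aminus aplus : ℝ) (ha : 0 < aminus) :
    ∃ κ₀ C γ₀ : ℝ, 0 < κ₀ ∧ 0 ≤ C ∧ 0 < γ₀ ∧ ∀ (n : ℕ) [NeZero n], 1 ≤ n → ∀ a : ℝ, aminus ≤ a → a ≤ aplus →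
      ∀ (N : Fin (d + 1) → ℕ) [∀ i, NeZero (N i)] (M₀ : ℕ), 1 ≤ M₀ → (∀ i, 2 * M₀ ≤ n * N i) →
        ∀ (Dg : Module.End ℝ (EuclideanSpace ℝ (VIdx n N))),
          (∀ A, Real.sqrt (B5Leibniz121.dirichlet
              (B5Leibniz121.axisWC (N := fun i => n * N i) (κ := Fin (d + 1))) A) ≤ ‖Dg A‖) →
        ∀ (a' : ℝ) (z₁ z₂ : B5TorusCover.Ctr (fun i => n * N i) M₀) (A : EuclideanSpace ℝ (VIdx n N)),
            ‖B5SmoothPartition.HSop (fun i => n * N i) M₀ (fun p : VIdx n N => p.1) z₁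
                (B5Local114.Kop
                  (B5Commutator128.kerOp (fun i j =>
                      -B5Leibniz121.lapKer B5Leibniz121.axisWC i j
                        + a' * B5Averaging120.gram120 ((n : ℝ) ^ (d + 1)) (B5AveragingTorus.avgKer n) i j
                        - (gradK n N * KReV n a N * kerRe n a N * QGReV n a N * divK n N) i j))
                  (B5SmoothPartition.HSop (fun i => n * N i) M₀ (fun p : VIdx n N => p.1)) z₂ A)‖
              ≤ (((4 * ((d + 1 : ℕ) : ℝ) / M₀ * Real.sqrt (2 * ((d + 1 : ℕ) : ℝ))
                        + 52 * ((d + 1 : ℕ) : ℝ) / (M₀ : ℝ) ^ 2)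
                      + 4 * ((d + 1 : ℕ) : ℝ) / M₀ * (4 * n) * |a'|) * Real.exp (4 + 4 * n / M₀)
                  + 4 * ((d + 1 : ℕ) : ℝ) / M₀
                    * torusConst126 (d + 1) (d + 1) 1 (Real.exp (κ₀ / ((d + 1) * n))) (Real.exp (κ₀ / ((d + 1) * n)))
                        1 C C γ₀ (κ₀ / ((d + 1) * n))
                    * (24 / (Real.exp 1 * torusRate126 (d + 1) (d + 1) 1 1 C C γ₀ (κ₀ / ((d + 1) * n))))
                    * (((d + 1 : ℕ) : ℝ) * B4Sect5Proof.latticeConst (d + 1)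
                        (torusRate126 (d + 1) (d + 1) 1 1 C C γ₀ (κ₀ / ((d + 1) * n)) / 8)) * Real.exp 7)
                * Real.exp (-(B5Walk131.twoDelta0 (torusRate126 (d + 1) (d + 1) 1 1 C C γ₀ (κ₀ / ((d + 1) * n))) M₀
                    * dist (B5TorusCover.ctrU (fun i => n * N i) M₀ z₁)
                        (B5TorusCover.ctrU (fun i => n * N i) M₀ z₂)))
                * (‖Dg A‖ + ‖A‖) := by
  obtain ⟨κ₀, C, γ₀, hκ, hC, hγ, h⟩ := h128_multiplier d aminus aplus ha
  refine ⟨κ₀, C, γ₀, hκ, hC, hγ, fun n _ hn1 a ha1 ha2 N _ M₀ hM h2N Dg hDg a' z₁ z₂ A => ?_⟩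
  have ha0 : 0 < a := lt_of_lt_of_le ha ha1
  have hδ : 0 ≤ κ₀ / ((d + 1) * n) := by
    have : (0 : ℝ) < n := by exact_mod_cast hn1
    positivity
  have h' := h n hn1 a ha1 ha2 N M₀ hM h2N Dg hDg (-a') (-gradK n N) (divK n N) _ _
    (posDecay_neg (gradK_posDecay n N hδ)) (divK_posDecay n N hδ) z₁ z₂ A
  rw [abs_neg] at h'
  have hprod : -gradK n N * OneV n N * KReV n a N * (QGReV n a N * OneV n N * OneV n N * KReV n a N)⁻¹
      * QGReV n a N * OneV n N * divK n N = -(gradK n N * KReV n a N * kerRe n a N * QGReV n a N * divK n N) := by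
    rw [← kernel_eq n hn1 a ha0 N]
    simp only [Matrix.neg_mul]
  have hlit : B5Commutator128.kerOp (fun i j : VIdx n N =>
        -B5Leibniz121.lapKer B5Leibniz121.axisWC i j
          + a' * B5Averaging120.gram120 ((n : ℝ) ^ (d + 1)) (B5AveragingTorus.avgKer n) i j
          - (gradK n N * KReV n a N * kerRe n a N * QGReV n a N * divK n N) i j)
      = -(B5Commutator128.kerOp (fun i j : VIdx n N => B5Leibniz121.lapKer B5Leibniz121.axisWC i j
            + (-a') * B5Averaging120.gram120 ((n : ℝ) ^ (d + 1)) (B5AveragingTorus.avgKer n) i j)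
          + B5Commutator128.kerOp (fun i j : VIdx n N =>
            -((-gradK n N * OneV n N * KReV n a N * (QGReV n a N * OneV n N * OneV n N * KReV n a N)⁻¹
                * QGReV n a N * OneV n N * divK n N) i j))) := by
    rw [← B5Commutator128.kerOp_add]
    refine kerOp_eq_neg _ _ fun i j => ?_
    rw [hprod, Matrix.neg_apply]
    ring
  rw [hlit, B5Averaging120.Kop_neg, LinearMap.neg_apply, map_neg, norm_neg]
  exact h'


/-! ### §6 (1.128) FULLY INSTANTIATED: `Dg := DgAxis` (‖Dg A‖ = √(dirichlet A)); inputs left `M₀`, `a′` -/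

/-- **B5 (1.128) in the torus multiplier model with `∂P∂^*` AND `|∇A|` instantiated**: the bound of `h128_gradient`
with `‖Dg A‖` replaced by the lattice gradient norm `√(dirichlet axisWC A)` (pv15-g6's `B5DirichletDg.DgAxis`);
the only inputs left are the mesh `M₀` and the coefficient `a′`. [cite: Balaban1984PropagatorsI, (1.128) p.38] -/
theorem h128_gradient_concrete (d : ℕ) (aminus aplus : ℝ) (ha : 0 < aminus) :
    ∃ κ₀ C γ₀ : ℝ, 0 < κ₀ ∧ 0 ≤ C ∧ 0 < γ₀ ∧ ∀ (n : ℕ) [NeZero n], 1 ≤ n → ∀ a : ℝ, aminus ≤ a → a ≤ aplus →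
      ∀ (N : Fin (d + 1) → ℕ) [∀ i, NeZero (N i)] (M₀ : ℕ), 1 ≤ M₀ → (∀ i, 2 * M₀ ≤ n * N i) →
        ∀ (a' : ℝ) (z₁ z₂ : B5TorusCover.Ctr (fun i => n * N i) M₀) (A : EuclideanSpace ℝ (VIdx n N)),
            ‖B5SmoothPartition.HSop (fun i => n * N i) M₀ (fun p : VIdx n N => p.1) z₁
                (B5Local114.Kop
                  (B5Commutator128.kerOp (fun i j => B5Leibniz121.lapKer B5Leibniz121.axisWC i j
                      + a' * B5Averaging120.gram120 ((n : ℝ) ^ (d + 1)) (B5AveragingTorus.avgKer n) i j)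
                    + B5Commutator128.kerOp (fun i j =>
                      -((gradK n N * KReV n a N * kerRe n a N * QGReV n a N * divK n N) i j)))
                  (B5SmoothPartition.HSop (fun i => n * N i) M₀ (fun p : VIdx n N => p.1)) z₂ A)‖
              ≤ (((4 * ((d + 1 : ℕ) : ℝ) / M₀ * Real.sqrt (2 * ((d + 1 : ℕ) : ℝ))
                        + 52 * ((d + 1 : ℕ) : ℝ) / (M₀ : ℝ) ^ 2)
                      + 4 * ((d + 1 : ℕ) : ℝ) / M₀ * (4 * n) * |a'|) * Real.exp (4 + 4 * n / M₀)
                  + 4 * ((d + 1 : ℕ) : ℝ) / M₀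
                    * torusConst126 (d + 1) (d + 1) 1 (Real.exp (κ₀ / ((d + 1) * n))) (Real.exp (κ₀ / ((d + 1) * n)))
                        1 C C γ₀ (κ₀ / ((d + 1) * n))
                    * (24 / (Real.exp 1 * torusRate126 (d + 1) (d + 1) 1 1 C C γ₀ (κ₀ / ((d + 1) * n))))
                    * (((d + 1 : ℕ) : ℝ) * B4Sect5Proof.latticeConst (d + 1)
                        (torusRate126 (d + 1) (d + 1) 1 1 C C γ₀ (κ₀ / ((d + 1) * n)) / 8)) * Real.exp 7)
                * Real.exp (-(B5Walk131.twoDelta0 (torusRate126 (d + 1) (d + 1) 1 1 C C γ₀ (κ₀ / ((d + 1) * n))) M₀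
                    * dist (B5TorusCover.ctrU (fun i => n * N i) M₀ z₁)
                        (B5TorusCover.ctrU (fun i => n * N i) M₀ z₂)))
                * (Real.sqrt (B5Leibniz121.dirichlet
                      (B5Leibniz121.axisWC (N := fun i => n * N i) (κ := Fin (d + 1))) A) + ‖A‖) := by
  obtain ⟨κ₀, C, γ₀, hκ, hC, hγ, h⟩ := h128_gradient d aminus aplus ha
  refine ⟨κ₀, C, γ₀, hκ, hC, hγ, fun n _ hn1 a ha1 ha2 N _ M₀ hM h2N a' z₁ z₂ A => ?_⟩
  have h' := h n hn1 a ha1 ha2 N M₀ hM h2N (DgAxis (fun i => n * N i) (Fin (d + 1)))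
    sqrt_dirichlet_le_norm_DgAxis a' z₁ z₂ A
  rwa [norm_DgAxis] at h'

end

end Literature.MathematicalPhysics.QuantumFieldTheory.Balaban1983to89.B5DPD126Gradient
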